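import Mathlib.MeasureTheory.Function.ConditionalExpectation.PullOut
import Mathlib.MeasureTheory.Function.FactorsThrough
import Mathlib.MeasureTheory.Integral.Bochner.ContinuousLinearMap
import Mathlib.Dynamics.Ergodic.MeasurePreserving
import HarnessLib

/-!
# Invariance of conditional expectations: a.e.-equal generating maps, measure-preserving maps,
# and a change of measure by a density measurable for the conditioning σ-algebra

Topic `Probability/Process`; theorems only, all for Mathlib's conditional expectation
`μ[f | m]` (`MeasureTheory.condExp`) of a Bochner-integrable `f : α → E` (`E` a real Banach
space) on a finite measure space `(α, m₀, μ)`.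

* `condExp_comap_congr_ae` — **σ-algebras generated by a.e.-equal maps.** If `p p' : α → β` are
  measurable and `p = p'` `μ`-a.e., then `μ[f | σ(p)] = μ[f | σ(p')]` `μ`-a.e., where
  `σ(p) = MeasurableSpace.comap p ‹_›`. (The two σ-algebras differ, but only by null sets.)
  Proof: `μ[f | σ(p)] = G ∘ p` for a measurable `G` (Doob–Dynkin,
  `StronglyMeasurable.exists_eq_measurable_comp`), so it is a.e. equal to the
  `σ(p')`-measurable `G ∘ p'`, and its integrals over `p' ⁻¹ S =ᵐ p ⁻¹ S` are those of `f`;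
  conclude by uniqueness (`ae_eq_condExp_of_forall_setIntegral_eq`).
* `condExp_comp_of_measurePreserving` — **transport under a measure-preserving map.** If
  `T : α → α'` pushes `μ` to `μ'` and `p : α' → β` is measurable, then
  `μ[f ∘ T | σ(p ∘ T)] = μ'[f | σ(p)] ∘ T` `μ`-a.e. Proof: `σ(p ∘ T) = T⁻¹ σ(p)`
  (`MeasurableSpace.comap_comp`), change of variables in the set integrals over
  `T ⁻¹ (p ⁻¹ S)` (`setIntegral_map`), uniqueness. The combination with the first lemma,
  `condExp_comp_of_measurePreserving_of_ae_eq`, replaces `σ(p ∘ T)` by `σ(q)` for any measurable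
  `q =ᵐ p ∘ T` (e.g. two versions of a flow that agree off a null set).
* `condExp_withDensity_ae_eq` — **Bayes invariance under an `m`-measurable density.** If
  `ρ : α → ℝ≥0∞` is measurable for the sub-σ-algebra `m ≤ m₀` with `∫⁻ ρ dμ < ∞`, and `f` is
  integrable for both `μ` and `ν = μ.withDensity ρ`, then `ν[f | m] = μ[f | m]` `ν`-a.e.
  Proof: for `B ∈ m`, `∫_B μ[f|m] dν = ∫_B ρ • μ[f|m] dμ = ∫_B μ[ρ • f|m] dμ = ∫_B ρ • f dμ
  = ∫_B f dν`, the middle step being the general pull-out property for the (possibly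
  unbounded) `m`-measurable factor `ρ.toReal` (`condExp_smul_of_aestronglyMeasurable_left`,
  which needs exactly the integrability of `ρ • f`, i.e. of `f` under `ν`); uniqueness under
  `ν`. No boundedness of `ρ` is assumed. `condExp_ae_eq_condExp_of_eq_withDensity` is the
  same statement for a measure `ν` given with `ν = μ.withDensity ρ`.

Both integrability hypotheses in the last lemma are needed with Mathlib's junk-value
convention (`μ[f|m] = 0` for non-integrable `f`): with `ρ = 𝟙_B`, `B ∈ m`, and `f` integrable
on `B` only, `ν[f|m] ≠ 0 = μ[f|m]` in general.

These are the three measure-theoretic facts behind "the compensator of a stationary functional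
is stationary": conditional expectations given the coarse state at a later time are the
time-shifted conditional expectations at time `0` under an invariant law, also under any law
whose density with respect to the invariant one is a function of the coarse state.

## References

Standard; e.g. O. Kallenberg, *Foundations of Modern Probability* (2nd ed., Springer 2002),
Lemma 1.13 (Doob–Dynkin) and Ch. 6 (conditional expectation: a.s. uniqueness, pull-out,
change of measure). All statements here are folklore.
-/

open MeasureTheory Filter Set
open scoped ENNReal

namespace Literature.Probability.Process

variable {α α' β E : Type*} {m m₀ : MeasurableSpace α} {μ : Measure α} {mα' : MeasurableSpace α'}
  {μ' : Measure α'} [mβ : MeasurableSpace β]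
  [NormedAddCommGroup E] [NormedSpace ℝ E] [CompleteSpace E]

/-! ### σ-algebras generated by almost everywhere equal maps -/

/-- **Conditional expectations given a.e.-equal maps agree a.e.** For a finite measure `μ`,
measurable `p p' : α → β` with `p = p'` `μ`-a.e. and any `f : α → E`:
`μ[f | σ(p)] =ᵐ[μ] μ[f | σ(p')]`, `σ(p) = mβ.comap p`. (Doob–Dynkin: `μ[f | σ(p)] = G ∘ p` with
`G` measurable, which is a.e. the `σ(p')`-measurable `G ∘ p'`; the generating sets `p ⁻¹ S` and
`p' ⁻¹ S` differ by a null set, so the defining set integrals agree; uniqueness of the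
conditional expectation.) For non-integrable `f` both sides are `0`. [folklore] -/
theorem condExp_comap_congr_ae [IsFiniteMeasure μ] {p p' : α → β} (hp : Measurable p)
    (hp' : Measurable p') (hpp' : p =ᵐ[μ] p') (f : α → E) :
    μ[f | mβ.comap p] =ᵐ[μ] μ[f | mβ.comap p'] := by
  by_cases hf : Integrable f μ
  swap
  · rw [condExp_of_not_integrable hf, condExp_of_not_integrable hf]
  -- Doob–Dynkin factorisation of `μ[f | σ(p)]` through `p`
  obtain ⟨G, hG, hgG⟩ :=
    (stronglyMeasurable_condExp (m := mβ.comap p) (μ := μ) (f := f)).exists_eq_measurable_comp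
  refine ae_eq_condExp_of_forall_setIntegral_eq hp'.comap_le hf
    (fun s _ _ => integrable_condExp.integrableOn) ?_ ?_
  · rintro _ ⟨S, hS, rfl⟩ -
    have hSS : p' ⁻¹' S =ᵐ[μ] p ⁻¹' S := hpp'.symm.preimage S
    rw [setIntegral_congr_set hSS, setIntegral_congr_set hSS]
    exact setIntegral_condExp hp.comap_le hf ⟨S, hS, rfl⟩
  · refine ⟨G ∘ p', hG.comp_measurable (comap_measurable p'), ?_⟩
    filter_upwards [hpp'] with x hx
    rw [hgG, Function.comp_apply, Function.comp_apply, hx]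

/-! ### Transport under a measure-preserving map -/

omit [CompleteSpace E] in
/-- Change of variables in a set integral over a preimage under a measure-preserving map
`T : (α, μ) → (α', μ')`: `∫_{T ⁻¹ s} g ∘ T dμ = ∫_s g dμ'` for `g` a.e.-strongly measurable and
`s` measurable (Mathlib's `setIntegral_map` with `map T μ = μ'`; the `MeasurableEmbedding`
version is `MeasurePreserving.setIntegral_preimage_emb`). [folklore] -/
theorem setIntegral_preimage_comp_of_measurePreserving {T : α → α'} (hT : MeasurePreserving T μ μ')
    {g : α' → E} (hg : AEStronglyMeasurable g μ') {s : Set α'} (hs : MeasurableSet s) :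
    ∫ x in T ⁻¹' s, g (T x) ∂μ = ∫ y in s, g y ∂μ' := by
  have hg' : AEStronglyMeasurable g (Measure.map T μ) := by rwa [hT.map_eq]
  simpa only [hT.map_eq] using (setIntegral_map hs hg' hT.measurable.aemeasurable).symm

/-- **Conditional expectation commutes with a measure-preserving change of variables.** For a
finite measure `μ` on `α`, a measure-preserving `T : (α, μ) → (α', μ')`, a measurable
`p : α' → β` and `f` integrable for `μ'`:
`μ[f ∘ T | σ(p ∘ T)] =ᵐ[μ] μ'[f | σ(p)] ∘ T`, `σ(p) = mβ.comap p`.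
(`σ(p ∘ T) = T⁻¹ σ(p)` by `MeasurableSpace.comap_comp`, so `μ'[f | σ(p)] ∘ T` is
`σ(p ∘ T)`-measurable; its integral over `T ⁻¹ (p ⁻¹ S)` is `∫_{p ⁻¹ S} μ'[f|σ(p)] dμ'
= ∫_{p ⁻¹ S} f dμ' = ∫_{T⁻¹(p⁻¹ S)} f ∘ T dμ`; uniqueness of the conditional expectation.)
In particular, for `T : α → α` preserving `μ` (a stationary dynamics) the conditional
expectation given the state observed through `p` at a later time is the time-shift of the one
at time `0`. [folklore] -/
theorem condExp_comp_of_measurePreserving [IsFiniteMeasure μ] {T : α → α'}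
    (hT : MeasurePreserving T μ μ') {p : α' → β} (hp : Measurable p) {f : α' → E}
    (hf : Integrable f μ') :
    μ[f ∘ T | mβ.comap (p ∘ T)] =ᵐ[μ] (μ'[f | mβ.comap p]) ∘ T := by
  haveI : IsFiniteMeasure μ' := by
    rw [← hT.map_eq]
    exact Measure.isFiniteMeasure_map μ T
  have hmT : mβ.comap (p ∘ T) ≤ m₀ := (hp.comp hT.measurable).comap_le
  have hTm : Measurable[mβ.comap (p ∘ T), mβ.comap p] T :=
    measurable_iff_comap_le.2 (by rw [MeasurableSpace.comap_comp])
  have hfT : Integrable (f ∘ T) μ := (hT.integrable_comp hf.aestronglyMeasurable).2 hf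
  have hg : Integrable (μ'[f | mβ.comap p]) μ' := integrable_condExp
  have hgT : Integrable ((μ'[f | mβ.comap p]) ∘ T) μ :=
    (hT.integrable_comp hg.aestronglyMeasurable).2 hg
  refine (ae_eq_condExp_of_forall_setIntegral_eq hmT hfT (fun s _ _ => hgT.integrableOn) ?_
    ?_).symm
  · rintro _ ⟨S, hS, rfl⟩ -
    rw [preimage_comp]
    change ∫ x in T ⁻¹' (p ⁻¹' S), (μ'[f | mβ.comap p]) (T x) ∂μ =
      ∫ x in T ⁻¹' (p ⁻¹' S), f (T x) ∂μ
    rw [setIntegral_preimage_comp_of_measurePreserving hT hg.aestronglyMeasurable (hp hS),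
      setIntegral_preimage_comp_of_measurePreserving hT hf.aestronglyMeasurable (hp hS)]
    exact setIntegral_condExp hp.comap_le hf ⟨S, hS, rfl⟩
  · exact (stronglyMeasurable_condExp.comp_measurable hTm).aestronglyMeasurable

/-- **Transport under a measure-preserving map, up to an a.e. modification of the observed
state.** As `condExp_comp_of_measurePreserving`, with the σ-algebra `σ(p ∘ T)` replaced by
`σ(q)` for any measurable `q : α → β` with `q = p ∘ T` `μ`-a.e. (e.g. the state read along two
versions of a flow that agree off a null set): `μ[f ∘ T | σ(q)] =ᵐ[μ] μ'[f | σ(p)] ∘ T`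
(combine with `condExp_comap_congr_ae`). [folklore] -/
theorem condExp_comp_of_measurePreserving_of_ae_eq [IsFiniteMeasure μ] {T : α → α'}
    (hT : MeasurePreserving T μ μ') {p : α' → β} (hp : Measurable p) {q : α → β}
    (hq : Measurable q) (hqT : q =ᵐ[μ] p ∘ T) {f : α' → E} (hf : Integrable f μ') :
    μ[f ∘ T | mβ.comap q] =ᵐ[μ] (μ'[f | mβ.comap p]) ∘ T :=
  (condExp_comap_congr_ae hq (hp.comp hT.measurable) hqT (f ∘ T)).trans
    (condExp_comp_of_measurePreserving hT hp hf)

/-! ### Change of measure by a density measurable for the conditioning σ-algebra -/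

/-- **Bayes invariance of the conditional expectation under an `m`-measurable density.** Let
`μ` be a finite measure on `(α, m₀)`, `m ≤ m₀` a sub-σ-algebra, `ρ : α → ℝ≥0∞` an
`m`-measurable density with `∫⁻ ρ dμ < ∞`, and `f : α → E` integrable for both `μ` and
`ν = μ.withDensity ρ`. Then `ν[f | m] =ᵐ[ν] μ[f | m]`: conditioning on `m` is the same under
both measures. (For `B ∈ m`: `∫_B μ[f|m] dν = ∫_B ρ • μ[f|m] dμ = ∫_B μ[ρ • f | m] dμ
= ∫_B ρ • f dμ = ∫_B f dν` by the pull-out property for the `m`-measurable, possibly unbounded,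
real factor `ρ.toReal` (`condExp_smul_of_aestronglyMeasurable_left`), which also shows that
`μ[f|m]` is `ν`-integrable; then uniqueness of `ν[f|m]`.) This is the abstract Bayes formula
`ν[f|m] = μ[ρ f|m] / μ[ρ|m]` in the case `μ[ρ|m] = ρ`; no boundedness of `ρ` is assumed, but
both integrability hypotheses are needed under Mathlib's convention `μ[f|m] = 0` for
non-integrable `f`. [folklore] -/
theorem condExp_withDensity_ae_eq [IsFiniteMeasure μ] (hm : m ≤ m₀)
    {ρ : α → ℝ≥0∞} (hρ : Measurable[m] ρ) (hρμ : ∫⁻ x, ρ x ∂μ ≠ ∞) {f : α → E}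
    (hfμ : Integrable f μ) (hfρ : Integrable f (μ.withDensity ρ)) :
    (μ.withDensity ρ)[f | m] =ᵐ[μ.withDensity ρ] μ[f | m] := by
  have hρ₀ : Measurable[m₀] ρ := hρ.mono hm le_rfl
  have hρ_top : ∀ᵐ x ∂μ, ρ x < ∞ := ae_lt_top hρ₀ hρμ
  haveI : IsFiniteMeasure (μ.withDensity ρ) := isFiniteMeasure_withDensity hρμ
  -- the real weight `r = ρ.toReal`, `m`-measurable
  have hr_m : StronglyMeasurable[m] (fun x => (ρ x).toReal) :=
    hρ.ennreal_toReal.stronglyMeasurable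
  have hrf : Integrable (fun x => (ρ x).toReal • f x) μ :=
    (integrable_withDensity_iff_integrable_smul' hρ₀ hρ_top).1 hfρ
  -- pull-out property for the `m`-measurable factor
  have hpull : μ[fun x => (ρ x).toReal • f x | m] =ᵐ[μ] fun x => (ρ x).toReal • (μ[f | m]) x :=
    condExp_smul_of_aestronglyMeasurable_left (f := fun x => (ρ x).toReal) (g := f)
      hr_m.aestronglyMeasurable hrf hfμ
  have hrg : Integrable (fun x => (ρ x).toReal • (μ[f | m]) x) μ := integrable_condExp.congr hpull
  have hg_int : Integrable (μ[f | m]) (μ.withDensity ρ) :=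
    (integrable_withDensity_iff_integrable_smul' hρ₀ hρ_top).2 hrg
  refine (ae_eq_condExp_of_forall_setIntegral_eq hm hfρ (fun s _ _ => hg_int.integrableOn) ?_
    stronglyMeasurable_condExp.aestronglyMeasurable).symm
  intro s hs _
  have hs₀ : MeasurableSet[m₀] s := hm s hs
  rw [setIntegral_withDensity_eq_setIntegral_toReal_smul hρ₀ (ae_restrict_of_ae hρ_top) _ hs₀,
    setIntegral_withDensity_eq_setIntegral_toReal_smul hρ₀ (ae_restrict_of_ae hρ_top) _ hs₀,
    setIntegral_congr_ae hs₀ (hpull.mono fun x hx _ => hx.symm)]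
  exact setIntegral_condExp hm hrf hs

/-- **Bayes invariance, for a measure given as `ν = μ.withDensity ρ`.** For finite measures
`μ, ν` on `(α, m₀)` with `ν = μ.withDensity ρ`, `ρ` measurable for the sub-σ-algebra `m ≤ m₀`,
and `f` integrable for `μ` and `ν`: `ν[f | m] =ᵐ[ν] μ[f | m]`
(`condExp_withDensity_ae_eq`; `∫⁻ ρ dμ = ν univ < ∞`). Typical use: `μ` an invariant law,
`ν` another law whose density is a function of a conditioned-upon coordinate. [folklore] -/
theorem condExp_ae_eq_condExp_of_eq_withDensity [IsFiniteMeasure μ] {ν : Measure α}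
    [IsFiniteMeasure ν] (hm : m ≤ m₀) {ρ : α → ℝ≥0∞} (hρ : Measurable[m] ρ)
    (hν : ν = μ.withDensity ρ) {f : α → E} (hfμ : Integrable f μ) (hfν : Integrable f ν) :
    ν[f | m] =ᵐ[ν] μ[f | m] := by
  subst hν
  refine condExp_withDensity_ae_eq hm hρ ?_ hfμ hfν
  rw [← setLIntegral_univ, ← withDensity_apply ρ MeasurableSet.univ]
  exact measure_ne_top _ _

end Literature.Probability.Process
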